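import Mathlib

/-!
# `BalabanUV.Beta.FP.MarginalUniqueness` — road «FP» for binder row D1, leaf (U3): UNIQUENESS OF THE MARGINAL CUBIC GAUGE VERTEX
# under HYPEROCTAHEDRAL (lattice) symmetry alone: a cubic germ that is invariant under the signed permutations of the four axes and
# Bose-antisymmetric (colour factor `f^{abc}` stripped) IS a multiple of the Yang–Mills germ — the would-be extra hypercubic invariant
# (all four indices equal) is killed by Bose antisymmetry.  Pure finite-dimensional invariant theory; no lattice, no analysis.

HONEST FRAMING (cell contract, verbatim): «discharging `BetaPertH` makes Bałaban's UV stability UNCONDITIONAL — a real constructive-QFT result;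
it is NOT the continuum limit and NOT the Clay problem.»  THIS MODULE DISCHARGES NOTHING of the wall: it is linear algebra over `Fin 4`.  Its USE
(skeleton `HOME/beta/skeletons/D1-b2b-balaban-beta-d1-p3.md`, leaf N7d, unit `b2b-balaban-beta-d1-p3`): the zero-momentum germ of the cubic vertex
of ANY gauge- and lattice-symmetric local action (in particular of the Gaussian fixed-point «perfect» action, whose cubic jet is not written in
closed form) is the Yang–Mills germ up to ONE scale — so the coefficient of `log` in the one-loop bubble sees only that scale (fixed separately by
the background Ward identity against the quadratic germ) and the continuum table (`SquareTable.leadingIntegrand (kappaBal N)`, an3).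
ABSOLUTE RULE (cell, verbatim): «No internally-minted statement may enter as a cited fact. Every hypothesis is either kernel-proved in this package or a
verbatim quotation of a PUBLISHED theorem with page reference.»  Nothing is cited; every hypothesis is a symmetry SHAPE on an abstract coefficient table.

ENCODING.  A cubic germ is the coefficient table `L μ ν λ κ i` of the trilinear, momentum-linear form
  `Φ(B¹,p; B²,q; B³,r) = Σ_{μνλκ} B¹_μ B²_ν B³_λ · (L μ ν λ κ 0 · p_κ + L μ ν λ κ 1 · q_κ)`,   `r = −p − q` eliminated,
the colour factor `f^{abc}` (totally antisymmetric) being stripped.  HYPOTHESES: `PermInvariant` / `FlipInvariant` = invariance of Φ under the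
hyperoctahedral group `B₄` (signed permutations acting on all vector indices); `Anti12` = Φ(B²,q;B¹,p;B³,r) = −Φ(B¹,p;B²,q;B³,r) coefficientwise;
`Anti13` = Φ(B³,r;B²,q;B¹,p) = −Φ(B¹,p;B²,q;B³,r) coefficientwise after substituting `r = −p − q` (the two families of equations below).  [Bose SYMMETRY of
the full vertex `f^{abc} ⊗ Φ` under simultaneous permutation of (colour, vector, momentum) labels = ANTISYMMETRY of Φ, since `f` is antisymmetric.]
THE YANG–MILLS GERM `ymGerm`: Φ_YM = (B¹·B²)((p−q)·B³) + (B²·B³)((q−r)·B¹) + (B³·B¹)((r−p)·B²) with `r = −p−q`, i.e. p-part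
`δ_{μν}δ_{λκ} + δ_{νλ}δ_{μκ} − 2δ_{λμ}δ_{νκ}`, q-part `−δ_{μν}δ_{λκ} + 2δ_{νλ}δ_{μκ} − δ_{λμ}δ_{νκ}`.
CONTENT: `ymGerm_anti12`, `ymGerm_anti13₀`, `ymGerm_anti13₁` (the encoding is consistent: the YM germ satisfies the Bose equations), `exists_perm_zero_one`
(transitivity gadget), `eq_zero_of_flip` (an axis of odd multiplicity kills the coefficient), **`cubic_unique`**: `PermInvariant L → FlipInvariant L → Anti12 L →
Anti13 L → ∀ μ ν λ κ i, L μ ν λ κ i = L 0 0 1 1 0 * ymGerm μ ν λ κ i`.  NOT BetaPertH, NOT continuum, NOT Clay.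
-/

namespace Summit.QuantumFields.BalabanUV.Beta.FP.MarginalUniqueness

/-- [our object] Axis indices in dimension four. -/
abbrev Idx := Fin 4

/-- [our object] A cubic germ: `L μ ν λ κ i` = coefficient of `B¹_μ B²_ν B³_λ (k_i)_κ`, `k_0 = p` (momentum of leg 1), `k_1 = q` (leg 2). -/
abbrev CubicGerm := Idx → Idx → Idx → Idx → Fin 2 → ℝ

/-- [our object] Kronecker delta. -/
def δ (a b : Idx) : ℝ := if a = b then 1 else 0

/-- [our object] `δ` is symmetric. -/
theorem δ_comm (a b : Idx) : δ a b = δ b a := by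
  unfold δ; by_cases h : a = b
  · simp [h]
  · simp [h, Ne.symm h]

/-- [our object] `δ a a = 1`. -/
@[simp] theorem δ_self (a : Idx) : δ a a = 1 := by simp [δ]

/-- [our object] `δ a b = 0` for `a ≠ b`. -/
theorem δ_of_ne {a b : Idx} (h : a ≠ b) : δ a b = 0 := by simp [δ, h]

/-- [our object] The reflection sign of axis `α` on a vector index `β`. -/
def rs (α β : Idx) : ℝ := if β = α then -1 else 1

/-- [our object] `rs α α = −1`. -/
@[simp] theorem rs_self (α : Idx) : rs α α = -1 := by simp [rs]

/-- [our object] `rs α β = 1` for `β ≠ α`. -/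
theorem rs_of_ne {α β : Idx} (h : β ≠ α) : rs α β = 1 := by simp [rs, h]

/-- [our object] Invariance under axis permutations (acting on all four vector indices). -/
def PermInvariant (L : CubicGerm) : Prop :=
  ∀ (σ : Equiv.Perm Idx) (μ ν lam κ : Idx) (i : Fin 2), L (σ μ) (σ ν) (σ lam) (σ κ) i = L μ ν lam κ i

/-- [our object] Invariance under axis reflections (each vector index along the reflected axis flips sign). -/
def FlipInvariant (L : CubicGerm) : Prop :=
  ∀ (α μ ν lam κ : Idx) (i : Fin 2), rs α μ * rs α ν * rs α lam * rs α κ * L μ ν lam κ i = L μ ν lam κ i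

/-- [our object] Bose antisymmetry under the exchange of legs 1 and 2 (`(B¹,p) ↔ (B²,q)`), coefficientwise. -/
def Anti12 (L : CubicGerm) : Prop :=
  (∀ μ ν lam κ : Idx, L ν μ lam κ 1 = -L μ ν lam κ 0) ∧ (∀ μ ν lam κ : Idx, L ν μ lam κ 0 = -L μ ν lam κ 1)

/-- [our object] Bose antisymmetry under the exchange of legs 1 and 3 (`(B¹,p) ↔ (B³,r)`, `r = −p−q`), coefficientwise:
`Φ(B³,r;B²,q;B¹,p) = Σ B¹_μB²_νB³_λ [−L λ ν μ κ 0 · p_κ + (L λ ν μ κ 1 − L λ ν μ κ 0) · q_κ]` must equal `−Φ`. -/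
def Anti13 (L : CubicGerm) : Prop :=
  (∀ μ ν lam κ : Idx, L lam ν μ κ 0 = L μ ν lam κ 0) ∧ (∀ μ ν lam κ : Idx, L lam ν μ κ 1 - L lam ν μ κ 0 = -L μ ν lam κ 1)

/-- [our object] **The Yang–Mills cubic germ** (colour `f^{abc}` stripped; `r = −p−q` eliminated). -/
def ymGerm : CubicGerm := fun μ ν lam κ i =>
  if i = 0 then δ μ ν * δ lam κ + δ ν lam * δ μ κ - 2 * (δ lam μ * δ ν κ)
  else -(δ μ ν * δ lam κ) + 2 * (δ ν lam * δ μ κ) - δ lam μ * δ ν κ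

/-! ## 1. The encoding is consistent: the Yang–Mills germ satisfies the Bose equations and is `B₄`-invariant under permutations -/

/-- [our object] `ymGerm` is Bose-antisymmetric under legs 1 ↔ 2. -/
theorem ymGerm_anti12 : Anti12 ymGerm := by
  constructor <;> intro μ ν lam κ <;> simp only [ymGerm, Fin.isValue, one_ne_zero, ↓reduceIte] <;>
    rw [δ_comm ν μ, δ_comm μ lam, δ_comm lam ν] <;> ring

/-- [our object] `ymGerm` is Bose-antisymmetric under legs 1 ↔ 3, `p`-part. -/
theorem ymGerm_anti13₀ : ∀ μ ν lam κ : Idx, ymGerm lam ν μ κ 0 = ymGerm μ ν lam κ 0 := by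
  intro μ ν lam κ
  simp only [ymGerm, Fin.isValue, ↓reduceIte]
  rw [δ_comm lam ν, δ_comm ν μ, δ_comm μ lam]
  ring

/-- [our object] `ymGerm` is Bose-antisymmetric under legs 1 ↔ 3, `q`-part. -/
theorem ymGerm_anti13₁ : ∀ μ ν lam κ : Idx, ymGerm lam ν μ κ 1 - ymGerm lam ν μ κ 0 = -ymGerm μ ν lam κ 1 := by
  intro μ ν lam κ
  simp only [ymGerm, Fin.isValue, one_ne_zero, ↓reduceIte]
  rw [δ_comm lam ν, δ_comm ν μ, δ_comm μ lam]
  ring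

/-- [our object] `ymGerm` satisfies `Anti13`. -/
theorem ymGerm_anti13 : Anti13 ymGerm := ⟨ymGerm_anti13₀, ymGerm_anti13₁⟩

/-- [our object] `δ` is invariant under axis permutations. -/
theorem δ_perm (σ : Equiv.Perm Idx) (a b : Idx) : δ (σ a) (σ b) = δ a b := by
  simp [δ, σ.injective.eq_iff]

/-- [our object] `ymGerm` is invariant under axis permutations. -/
theorem ymGerm_permInvariant : PermInvariant ymGerm := by
  intro σ μ ν lam κ i
  simp only [ymGerm, δ_perm]

/-! ## 2. Values of the Yang–Mills germ on the index patterns -/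

/-- [our object] -/
theorem ymGerm_aabb {μ lam : Idx} (h : μ ≠ lam) (i : Fin 2) : ymGerm μ μ lam lam i = if i = 0 then 1 else -1 := by
  fin_cases i <;> simp [ymGerm, δ_of_ne h, δ_of_ne (Ne.symm h)]

/-- [our object] -/
theorem ymGerm_abab {μ ν : Idx} (h : μ ≠ ν) (i : Fin 2) : ymGerm μ ν μ ν i = if i = 0 then -2 else -1 := by
  fin_cases i <;> simp [ymGerm, δ_of_ne h, δ_of_ne (Ne.symm h)]

/-- [our object] -/
theorem ymGerm_abba {μ ν : Idx} (h : μ ≠ ν) (i : Fin 2) : ymGerm μ ν ν μ i = if i = 0 then 1 else 2 := by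
  fin_cases i <;> simp [ymGerm, δ_of_ne h, δ_of_ne (Ne.symm h)]

/-- [our object] The all-indices-equal pattern: the Yang–Mills germ VANISHES there (and so does every admissible germ, below). -/
theorem ymGerm_aaaa (μ : Idx) (i : Fin 2) : ymGerm μ μ μ μ i = 0 := by
  fin_cases i <;> simp [ymGerm] <;> norm_num

/-- [our object] Zero pattern `(μ, μ, μ, κ)`, `κ ≠ μ`. -/
theorem ymGerm_aaab {μ κ : Idx} (h : μ ≠ κ) (i : Fin 2) : ymGerm μ μ μ κ i = 0 := by
  fin_cases i <;> simp [ymGerm, δ_of_ne h]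

/-- [our object] Zero pattern `(μ, μ, λ, κ)`, `μ ≠ λ`, `λ ≠ κ`. -/
theorem ymGerm_aabc {μ lam κ : Idx} (h1 : μ ≠ lam) (h2 : lam ≠ κ) (i : Fin 2) : ymGerm μ μ lam κ i = 0 := by
  fin_cases i <;> simp [ymGerm, δ_of_ne h1, δ_of_ne (Ne.symm h1), δ_of_ne h2]

/-- [our object] Zero pattern `(μ, ν, μ, κ)`, `μ ≠ ν`, `ν ≠ κ`. -/
theorem ymGerm_abac {μ ν κ : Idx} (h1 : μ ≠ ν) (h2 : ν ≠ κ) (i : Fin 2) : ymGerm μ ν μ κ i = 0 := by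
  fin_cases i <;> simp [ymGerm, δ_of_ne h1, δ_of_ne (Ne.symm h1), δ_of_ne h2]

/-- [our object] Zero pattern `(μ, ν, λ, μ)`, `μ ≠ ν`, `ν ≠ λ`, `μ ≠ λ`. -/
theorem ymGerm_abca {μ ν lam : Idx} (h1 : μ ≠ ν) (h2 : ν ≠ lam) (h3 : μ ≠ lam) (i : Fin 2) : ymGerm μ ν lam μ i = 0 := by
  fin_cases i <;> simp [ymGerm, δ_of_ne h1, δ_of_ne h2, δ_of_ne (Ne.symm h3)]

/-- [our object] Zero pattern `(μ, ν, λ, κ)` with `μ ∉ {ν, λ, κ}`. -/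
theorem ymGerm_abcd {μ ν lam κ : Idx} (h1 : μ ≠ ν) (h2 : μ ≠ lam) (h3 : μ ≠ κ) (i : Fin 2) : ymGerm μ ν lam κ i = 0 := by
  fin_cases i <;> simp [ymGerm, δ_of_ne h1, δ_of_ne (Ne.symm h2), δ_of_ne h3]

/-! ## 3. Two gadgets: transitivity of `S₄` on ordered pairs, and the reflection kill -/

/-- [our object] For `μ ≠ λ` there is an axis permutation with `σ 0 = μ`, `σ 1 = λ`. -/
theorem exists_perm_zero_one {μ lam : Idx} (h : μ ≠ lam) : ∃ σ : Equiv.Perm Idx, σ 0 = μ ∧ σ 1 = lam := by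
  let τ : Equiv.Perm Idx := Equiv.swap 0 μ
  have hτ0 : τ 0 = μ := by simp [τ]
  have hτl : τ.symm lam ≠ 0 := by
    intro h0
    have : lam = τ 0 := by rw [← h0]; simp
    exact h (by rw [this, hτ0])
  refine ⟨τ * Equiv.swap 1 (τ.symm lam), ?_, ?_⟩
  · rw [Equiv.Perm.mul_apply, Equiv.swap_apply_of_ne_of_ne (by decide) hτl.symm, hτ0]
  · rw [Equiv.Perm.mul_apply, Equiv.swap_apply_left]; simp

/-- [our object] There is an axis permutation with `σ 0 = μ`. -/
theorem exists_perm_zero (μ : Idx) : ∃ σ : Equiv.Perm Idx, σ 0 = μ := ⟨Equiv.swap 0 μ, by simp⟩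

variable {L : CubicGerm}

/-- [our object] REFLECTION KILL: if flipping axis `α` changes the sign of the monomial (product of the four signs `= −1`), the coefficient vanishes. -/
theorem eq_zero_of_flip (hF : FlipInvariant L) (α : Idx) {μ ν lam κ : Idx} (i : Fin 2)
    (hs : rs α μ * rs α ν * rs α lam * rs α κ = -1) : L μ ν lam κ i = 0 := by
  have h := hF α μ ν lam κ i
  rw [hs] at h
  linarith

/-- [our object] PATTERN TRANSPORT `(0,0,1,1) ↦ (μ,μ,λ,λ)`. -/
theorem val_aabb (hP : PermInvariant L) {μ lam : Idx} (h : μ ≠ lam) (i : Fin 2) : L μ μ lam lam i = L 0 0 1 1 i := by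
  obtain ⟨σ, h0, h1⟩ := exists_perm_zero_one h
  have := hP σ 0 0 1 1 i
  rwa [h0, h1] at this

/-- [our object] PATTERN TRANSPORT `(0,1,0,1) ↦ (μ,ν,μ,ν)`. -/
theorem val_abab (hP : PermInvariant L) {μ ν : Idx} (h : μ ≠ ν) (i : Fin 2) : L μ ν μ ν i = L 0 1 0 1 i := by
  obtain ⟨σ, h0, h1⟩ := exists_perm_zero_one h
  have := hP σ 0 1 0 1 i
  rwa [h0, h1] at this

/-- [our object] PATTERN TRANSPORT `(0,1,1,0) ↦ (μ,ν,ν,μ)`. -/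
theorem val_abba (hP : PermInvariant L) {μ ν : Idx} (h : μ ≠ ν) (i : Fin 2) : L μ ν ν μ i = L 0 1 1 0 i := by
  obtain ⟨σ, h0, h1⟩ := exists_perm_zero_one h
  have := hP σ 0 1 1 0 i
  rwa [h0, h1] at this

/-- [our object] PATTERN TRANSPORT `(0,0,0,0) ↦ (μ,μ,μ,μ)`. -/
theorem val_aaaa (hP : PermInvariant L) (μ : Idx) (i : Fin 2) : L μ μ μ μ i = L 0 0 0 0 i := by
  obtain ⟨σ, h0⟩ := exists_perm_zero μ
  have := hP σ 0 0 0 0 i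
  rwa [h0] at this

/-! ## 4. The Bose equations on the eight pattern coefficients -/

/-- [our object] THE EIGHT PATTERN COEFFICIENTS ARE `(c, −2c, c, 0 ∣ −c, −c, 2c, 0)`, `c = L 0 0 1 1 0`. -/
theorem pattern_values (hP : PermInvariant L) (h12 : Anti12 L) (h13 : Anti13 L) :
    L 0 0 1 1 1 = -L 0 0 1 1 0 ∧ L 0 1 0 1 0 = -2 * L 0 0 1 1 0 ∧ L 0 1 0 1 1 = -L 0 0 1 1 0 ∧
      L 0 1 1 0 0 = L 0 0 1 1 0 ∧ L 0 1 1 0 1 = 2 * L 0 0 1 1 0 ∧ L 0 0 0 0 0 = 0 ∧ L 0 0 0 0 1 = 0 := by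
  have h10 : (1 : Idx) ≠ 0 := by decide
  -- transports of the two non-canonical tuples met below
  have t1001 : ∀ i, L 1 0 0 1 i = L 0 1 1 0 i := fun i => val_abba hP h10 i
  have t1010 : ∀ i, L 1 0 1 0 i = L 0 1 0 1 i := fun i => val_abab hP h10 i
  -- the Bose equations at canonical tuples
  have e1 : L 0 0 1 1 1 = -L 0 0 1 1 0 := h12.1 0 0 1 1
  have e2 : L 1 0 0 1 1 = -L 0 1 0 1 0 := h12.1 0 1 0 1
  have e3 : L 1 0 1 0 1 = -L 0 1 1 0 0 := h12.1 0 1 1 0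
  have e4 : L 1 0 0 1 0 = L 0 0 1 1 0 := h13.1 0 0 1 1
  have e5 : L 1 0 0 1 1 - L 1 0 0 1 0 = -L 0 0 1 1 1 := h13.2 0 0 1 1
  have e6 : L 0 1 0 1 1 - L 0 1 0 1 0 = -L 0 1 0 1 1 := h13.2 0 1 0 1
  have e7 : L 0 0 0 0 1 - L 0 0 0 0 0 = -L 0 0 0 0 1 := h13.2 0 0 0 0
  have e8 : L 0 0 0 0 1 = -L 0 0 0 0 0 := h12.1 0 0 0 0
  rw [t1001] at e2 e4 e5
  rw [t1010] at e3
  refine ⟨e1, ?_, ?_, e4, ?_, ?_, ?_⟩ <;> linarith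

/-! ## 5. THE UNIQUENESS THEOREM -/

/-- [our object] **UNIQUENESS OF THE MARGINAL CUBIC GAUGE VERTEX UNDER HYPEROCTAHEDRAL SYMMETRY.**  A cubic germ invariant under the signed
permutations of the four axes and Bose-antisymmetric (legs 1 ↔ 2 and 1 ↔ 3; colour `f^{abc}` stripped) is `c · ymGerm`, `c = L 0 0 1 1 0`.
In particular the hypercubic-but-not-`O(4)` invariant `Σ_μ B¹_μ B²_μ B³_μ k_μ` has coefficient ZERO (`val_aaaa` + `pattern_values`). -/
theorem cubic_unique (hP : PermInvariant L) (hF : FlipInvariant L) (h12 : Anti12 L) (h13 : Anti13 L)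
    (μ ν lam κ : Idx) (i : Fin 2) : L μ ν lam κ i = L 0 0 1 1 0 * ymGerm μ ν lam κ i := by
  obtain ⟨ea1, eb0, eb1, ec0, ec1, ed0, ed1⟩ := pattern_values hP h12 h13
  by_cases hmn : μ = ν
  · subst hmn
    by_cases hlk : lam = κ
    · subst hlk
      by_cases hml : μ = lam
      · subst hml
        rw [val_aaaa hP μ i, ymGerm_aaaa]
        fin_cases i <;> simp [ed0, ed1]
      · rw [val_aabb hP hml i, ymGerm_aabb hml]
        fin_cases i <;> simp [ea1]
    · by_cases hml : μ = lam
      · subst hml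
        rw [eq_zero_of_flip hF κ i (by rw [rs_of_ne hlk, rs_self]; norm_num), ymGerm_aaab hlk, mul_zero]
      · rw [eq_zero_of_flip hF lam i (by rw [rs_of_ne hml, rs_self, rs_of_ne (Ne.symm hlk)]; norm_num),
          ymGerm_aabc hml hlk, mul_zero]
  · by_cases hml : μ = lam
    · subst hml
      by_cases hnk : ν = κ
      · subst hnk
        rw [val_abab hP hmn i, ymGerm_abab hmn]
        fin_cases i <;> simp [eb0, eb1, mul_comm]
      · rw [eq_zero_of_flip hF ν i (by rw [rs_of_ne hmn, rs_self, rs_of_ne (Ne.symm hnk)]; norm_num),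
          ymGerm_abac hmn hnk, mul_zero]
    · by_cases hmk : μ = κ
      · subst hmk
        by_cases hnl : ν = lam
        · subst hnl
          rw [val_abba hP hmn i, ymGerm_abba hmn]
          fin_cases i <;> simp [ec0, ec1, mul_comm]
        · rw [eq_zero_of_flip hF ν i (by rw [rs_of_ne hmn, rs_self, rs_of_ne (Ne.symm hnl)]; norm_num),
            ymGerm_abca hmn hnl hml, mul_zero]
      · rw [eq_zero_of_flip hF μ i (by rw [rs_self, rs_of_ne (Ne.symm hmn), rs_of_ne (Ne.symm hml), rs_of_ne (Ne.symm hmk)]; norm_num),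
          ymGerm_abcd hmn hml hmk, mul_zero]

/-- [our object] COROLLARY: the all-indices-equal coefficient of an admissible cubic germ vanishes. -/
theorem all_equal_coeff_eq_zero (hP : PermInvariant L) (hF : FlipInvariant L) (h12 : Anti12 L) (h13 : Anti13 L)
    (μ : Idx) (i : Fin 2) : L μ μ μ μ i = 0 := by
  rw [cubic_unique hP hF h12 h13, ymGerm_aaaa, mul_zero]

end Summit.QuantumFields.BalabanUV.Beta.FP.MarginalUniqueness
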